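import Summits.Ventures.YMGap.Thresholds.LatticeBakryEmeryGradientBridge
import Summits.Ventures.YMGap.Thresholds.MassGapFromUniformPoincare
import HarnessLib

/-!
# Venture YMGap — the mass gap at the sharp window from a GRADIENT-FORM uniform-Poincaré ⇒ mixing
# principle (referee F-175: the principle in Stroock–Zegarlinski's own currency)

HONEST FRAMING: venture file (cell `pub-ymgap`, track (a), seat p2); bookkeeping, no new number. The
sibling file `MassGapFromUniformPoincare.lean` isolates the hypothesis shape `PoincareMixingPrinciple`
("uniform kernel Poincaré inequality ⇒ unique DLR state + exponential clustering") with the Poincaré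
inequality in the LIPSCHITZ form `Var ≤ (1/K) ∑_e L_e²`. Stroock–Zegarlinski (J. Funct. Anal. 104 (1992);
CMP 144 (1992)) state the uniform Poincaré / spectral-gap hypothesis in the DIRICHLET-FORM currency
`Var_γ(F) ≤ (1/K) ∫ |∇F|² dγ`; for smooth `F` the Dirichlet form implies the Lipschitz form, not
conversely, so a principle with the Dirichlet-form hypothesis is the WEAKER (easier to obtain from the
printed theorem) assumption (referee F-175). This file types that version —
`PoincareMixingPrincipleGrad` (HYPOTHESIS SHAPE, not a named fact, not claimed) with hypothesis
`UniformKernelPoincareGrad` = `Var_{γ_E(·|η)}(F) ≤ (1/K) ∑_{e∈E} ∫ linkGradSq E f e dγ_E(·|η)` in the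
`linkGradSq` currency of the tree's kernel log-Sobolev fact — and proves: the gradient-form uniform
kernel Poincaré inequality HOLDS hypothesis-free at every `|β| < 1/(8d)` with `K = N/2 - 4dN|β|`
(`uniformKernelPoincareGrad_sharp`, from `kernel_variance_le_linkGradSq` and
`regionWilsonHessianBound_four_d`); the gradient form implies the Lipschitz form
(`uniformKernelPoincare_of_grad`), so `PoincareMixingPrinciple → PoincareMixingPrincipleGrad`
(`poincareMixingPrincipleGrad_of_lipschitz`: the new principle is weaker); and
`PoincareMixingPrincipleGrad d N → MassGapBelow d N (1/(8d))` (all `N ≥ 1`, `d ≥ 1`),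
`→ ImprovedThreshold d N (1/(8d))` (`d ≥ 3`). WHAT IT IS NOT: no mixing principle is proved or cited as
a fact here; test functions are smooth (`C^∞`) matrix-cylinder functions.

## References

* D. W. Stroock, B. Zegarlinski, J. Funct. Anal. 104 (1992) 299–326; Comm. Math. Phys. 144 (1992) 303–323.
* H. Shen, R. Zhu, X. Zhu, CMP 400 (2023) 805–851, Thm 4.2 / Cor 4.4 (the Poincaré inequality (4.11)).
-/

noncomputable section

open scoped Matrix ComplexConjugate BigOperators Matrix.Norms.Frobenius ContDiff Topology ProbabilityTheory
open Matrix Complex Finset MeasureTheory Filter ProbabilityTheory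
open Literature.MathematicalPhysics.QuantumFieldTheory
open Literature.MathematicalPhysics.QuantumLattice (fundamentalRep continuous_fundamentalRep LGConfig ymSpecification
  isProbabilityMeasure_ymSpecification)
open Literature.MathematicalPhysics.QuantumFieldTheory.SUNBakryEmery (SUN)

namespace Summit.Ventures.YMGap

namespace LatticeBakryEmery

variable {d N : ℕ}

variable (d N) in
/-- **Uniform kernel Poincaré inequality, gradient (Dirichlet-form) currency** at 't Hooft coupling `β`
with constant `1/K`: for every finite edge set `E`, exterior `η` and smooth `f`,
`Var_{γ_E(·|η)}(f((U_e)_{e∈E})) ≤ (1/K) ∑_{e∈E} ∫ linkGradSq E f e dγ_E(·|η)` (the tree's `linkGradSq`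
= squared left-invariant frame gradient in the link `e`). Hypothesis/conclusion SHAPE; proved below at
`K = N/2 - 4dN|β|`. -/
def UniformKernelPoincareGrad (β K : ℝ) : Prop :=
  ∀ (E : Finset (Literature.MathematicalPhysics.QuantumFieldTheory.ZdEdge d)) (η : LGConfig d (SUN N))
    (f : Cfg ↥E N → ℝ), ContDiff ℝ ∞ f →
      Var[matrixCylinder E f; ymSpecification (fundamentalRep (Fin N)) ((N : ℝ) * β) E η] ≤
        1 / K * ∑ e : ↥E, ∫ U, linkGradSq E f e (fun e' => (U e' : Matrix (Fin N) (Fin N) ℂ))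
          ∂(ymSpecification (fundamentalRep (Fin N)) ((N : ℝ) * β) E η)

/-- The gradient-form uniform kernel Poincaré inequality from any regional Hessian constant
(kernel theorem `kernel_variance_le_linkGradSq`). -/
theorem uniformKernelPoincareGrad_of_regionHessianBound {Λ₀ : ℝ} (hH : RegionWilsonHessianBound d N Λ₀)
    (hN : N ≠ 0) (β : ℝ) (hK : 0 < (N : ℝ) / 2 - N * |β| * Λ₀) :
    UniformKernelPoincareGrad d N β ((N : ℝ) / 2 - N * |β| * Λ₀) :=
  fun E η _ hf => kernel_variance_le_linkGradSq hH hN β hK E η hf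

/-- **The gradient-form uniform kernel Poincaré inequality at the sharp window** `|β| < 1/(8d)`,
`K = N/2 - 4dN|β|`, all `N ≥ 1`, `d ≥ 1` — hypothesis-free kernel theorem. -/
theorem uniformKernelPoincareGrad_sharp (hd : 1 ≤ d) (hN : 1 ≤ N) {β : ℝ}
    (hβ : |β| < HessianSharp.sharpThresholdSU d) :
    UniformKernelPoincareGrad d N β (HessianSharp.sharpBakryEmeryConstSU N d β) := by
  have hK : 0 < HessianSharp.sharpBakryEmeryConstSU N d β :=
    (HessianSharp.sharpBakryEmeryConstSU_pos_iff hd hN β).2 hβ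
  rw [HessianSharp.sharpBakryEmeryConstSU_eq] at hK ⊢
  exact uniformKernelPoincareGrad_of_regionHessianBound
    (HessianSharp.regionWilsonHessianBound_four_d (d := d) (N := N)) (by omega) β hK

/-- **Gradient form ⇒ Lipschitz form** (for `K > 0`): at `SU(N)^E` configurations
`∑_e linkGradSq E f e = Γ(f,f) ≤ ∑_e L_e²` for a smooth per-link `L_e`-Lipschitz `f`
(`Gam_eq_sum_linkGradSq`, `Gam_le_of_linkLipschitz`), and the kernel is a probability measure. -/
theorem uniformKernelPoincare_of_grad (hN : N ≠ 0) {β K : ℝ} (hK : 0 < K)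
    (h : UniformKernelPoincareGrad d N β K) : UniformKernelPoincare d N β K := by
  intro E η f hf Lc hL hLip
  haveI : IsProbabilityMeasure (ymSpecification (fundamentalRep (Fin N)) ((N : ℝ) * β) E η) :=
    isProbabilityMeasure_ymSpecification (fundamentalRep (Fin N)) (continuous_fundamentalRep (Fin N)) _ E η
  refine (h E η f hf).trans (mul_le_mul_of_nonneg_left ?_ (by positivity))
  -- pointwise: `∑_e linkGradSq E f e (U_E) = Γ(f,f)(emb U_E) ≤ ∑_e L_e²`
  have hpt : ∀ U : LGConfig d (SUN N),
      ∑ e : ↥E, linkGradSq E f e (fun e' => (U e' : Matrix (Fin N) (Fin N) ℂ)) ≤ ∑ e, Lc e ^ 2 := by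
    intro U
    have h1 := Gam_eq_sum_linkGradSq hN E hf (fun e : ↥E => U e)
    have h2 := Gam_le_of_linkLipschitz hN hf hL hLip (fun e : ↥E => U e)
    rw [h1] at h2
    exact h2
  -- each summand is continuous, hence integrable
  have hc : ∀ e : ↥E, Continuous fun U : LGConfig d (SUN N) =>
      linkGradSq E f e (fun e' => (U e' : Matrix (Fin N) (Fin N) ℂ)) := by
    intro e
    have h1 : ∀ U : LGConfig d (SUN N), linkGradSq E f e (fun e' => (U e' : Matrix (Fin N) (Fin N) ℂ)) =
        ∑ α : SUNBakryEmery.FrameIdx N, algD (lk e (SUNBakryEmery.frame α)) f (emb (fun e' : ↥E => U e')) ^ 2 := by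
      intro U
      unfold linkGradSq
      rw [show (fun e' : ↥E => (U e' : Matrix (Fin N) (Fin N) ℂ)) = emb (fun e' : ↥E => U e') from rfl,
        sum_sq_deriv_update_eq hN hf _ e (emb_mem_unitaryGroup _ e)]
    simp_rw [h1]
    refine continuous_finsetSum _ fun α _ => ?_
    refine ((contDiff_algD hf _).continuous.comp ?_).pow 2
    exact continuous_emb.comp (continuous_pi fun e' => continuous_apply _)
  have hint : ∀ e : ↥E, Integrable (fun U : LGConfig d (SUN N) =>
      linkGradSq E f e (fun e' => (U e' : Matrix (Fin N) (Fin N) ℂ)))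
      (ymSpecification (fundamentalRep (Fin N)) ((N : ℝ) * β) E η) :=
    fun e => (hc e).integrable_of_hasCompactSupport (HasCompactSupport.of_compactSpace _)
  rw [← integral_finsetSum _ fun e _ => hint e]
  calc ∫ U, ∑ e : ↥E, linkGradSq E f e (fun e' => (U e' : Matrix (Fin N) (Fin N) ℂ))
        ∂(ymSpecification (fundamentalRep (Fin N)) ((N : ℝ) * β) E η)
      ≤ ∫ _U, ∑ e, Lc e ^ 2 ∂(ymSpecification (fundamentalRep (Fin N)) ((N : ℝ) * β) E η) :=
        integral_mono (integrable_finsetSum _ fun e _ => hint e) (integrable_const _) hpt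
    _ = ∑ e, Lc e ^ 2 := by rw [integral_const, smul_eq_mul, probReal_univ, one_mul]

variable (d N) in
/-- **The uniform-Poincaré ⇒ mixing principle, gradient-form hypothesis** (HYPOTHESIS SHAPE — the form
in which Stroock–Zegarlinski's equivalence "uniform spectral gap ⇔ uniform LSI ⇔ Dobrushin–Shlosman
mixing" for compact continuous spins with finite-range interactions is stated in print, with the
Poincaré inequality in the Dirichlet-form currency; NOT a named fact, NOT claimed): a gradient-form
uniform kernel Poincaré inequality with a positive constant at coupling `β` forces a unique DLR state
and exponential clustering (SZZ form) of every tight limit at `β`. -/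
def PoincareMixingPrincipleGrad : Prop :=
  ∀ (β K : ℝ), 0 < K → UniformKernelPoincareGrad d N β K →
    Literature.Probability.LatticeModels.HasUniqueGibbsMeasure
        (ymSpecification (d := d) (fundamentalRep (Fin N)) ((N : ℝ) * β)) ∧
      SZZExponentialClustering d N β

/-- The gradient-form principle is WEAKER than (implied by) the Lipschitz-form principle of the sibling
file (for `N ≥ 1`): a gradient-form uniform PI gives the Lipschitz-form one. -/
theorem poincareMixingPrincipleGrad_of_lipschitz (hN : N ≠ 0) (hP : PoincareMixingPrinciple d N) :
    PoincareMixingPrincipleGrad d N :=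
  fun β K hK h => hP β K hK (uniformKernelPoincare_of_grad hN hK h)

/-- **Mass gap on the whole sharp window from the gradient-form principle**:
`PoincareMixingPrincipleGrad d N → MassGapBelow d N (1/(8d))` for all `N ≥ 1`, `d ≥ 1`. -/
theorem massGapBelow_sharp_of_poincarePrincipleGrad (hP : PoincareMixingPrincipleGrad d N) (hd : 1 ≤ d)
    (hN : 1 ≤ N) : MassGapBelow d N (HessianSharp.sharpThresholdSU d) := by
  intro β hβ
  have hK : 0 < HessianSharp.sharpBakryEmeryConstSU N d β :=
    (HessianSharp.sharpBakryEmeryConstSU_pos_iff hd hN β).2 hβ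
  obtain ⟨hu, hc⟩ := hP β _ hK (uniformKernelPoincareGrad_sharp hd hN hβ)
  exact HessianSharp.massGapAt_of_hasUniqueGibbsMeasure hu hc

/-- **The track-(a) target type from ONE gradient-form principle**: for `d ≥ 3`, `N ≥ 1`,
`PoincareMixingPrincipleGrad d N → ImprovedThreshold d N (1/(8d))`. -/
theorem improvedThreshold_sharp_of_poincarePrincipleGrad (hP : PoincareMixingPrincipleGrad d N) (hd : 3 ≤ d)
    (hN : 1 ≤ N) : ImprovedThreshold d N (HessianSharp.sharpThresholdSU d) :=
  ⟨HessianSharp.szzThresholdSU_lt_sharpThresholdSU hd,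
    massGapBelow_sharp_of_poincarePrincipleGrad hP (le_trans (by norm_num) hd) hN⟩

end LatticeBakryEmery

end Summit.Ventures.YMGap
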